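import Mathlib
import Summits.Ventures.PercRepro.TriangleCapMantelStability

/-!
# PercRepro — THE DENSE-CORNER STABILITY REDUCED TO THE ONE-TRIANGLE CASE, and the triangle-free cells
off the diagonal (p3, gen 34; part 31)

The conjecture of record for the dense corner (P3-TRIANGLE-CAP.md §10as(c2)): a `K₄⁻`-free graph on `k ≥ 7`
vertices with `m ≥ 2k − 3` edges that is not complete bipartite spanning has `Σ_v d(v)² ≤ m·k − (k − 2)`, so
that every cell one below the diagonal is `(m − 1)(k − 2)/2`.  Two of its three cases are theorems:

* `cliqueFree_of_card_triangles3_eq_zero` — no ordered triangle means triangle-free;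
* **`stability_of_cliqueFree_off_diagonal`** — a triangle-free graph with `m ≠ a (k − a)` for every `a` has
  `Σ_v d(v)² + (k − 2) ≤ m·k` (no complete bipartite spanning graph has `m` edges, so TriangleCapMantelStability
  applies): the triangle-free cherry maximum off the diagonal is at most `(m − 1)(k − 2)/2`
  (`cherries_le_of_cliqueFree_off_diagonal`);
* **`stability_of_two_triangles`** — a `K₄⁻`-free graph on `k ≥ 10` vertices with at least two triangles
  (`12 ≤ |T₃|`) has `Σ_v d(v)² + (k − 2) ≤ m·k`: two triangles cost `2 (k − 6) ≥ k − 2`;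
* **`dense_stability_of_not_one_triangle`** — for `k ≥ 10`, every `K₄⁻`-free graph that is not complete
  bipartite spanning and has either no triangle or at least two satisfies `Σ_v d(v)² + (k − 2) ≤ m·k`.

What remains of the conjecture for `k ≥ 10` is therefore the ONE-TRIANGLE case in the dense corner, and for
`7 ≤ k ≤ 9` the graphs with triangles (at `(7, 11)` the bound is attained with `2` and `3` triangles).
Axioms: standard.
-/

namespace PercRepro

namespace TriangleCap

namespace C047

open Finset

variable {V : Type*} [Fintype V] [DecidableEq V]

/-- No ordered triangle means triangle-free. -/
theorem cliqueFree_of_card_triangles3_eq_zero (D : SimpleGraph V) [DecidableRel D.Adj]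
    (h : (triangles3 D).card = 0) : D.CliqueFree 3 := by
  intro S hS
  rw [SimpleGraph.is3Clique_iff] at hS
  obtain ⟨a, b, c, hab, hac, hbc, -⟩ := hS
  have hmem : ((a, b), c) ∈ triangles3 D := (mem_triangles3 D _).mpr ⟨hab, hac, hbc⟩
  have := card_pos.mpr ⟨_, hmem⟩
  omega

/-- **TRIANGLE-FREE, OFF THE DIAGONAL:** if no `a` has `m = a (k − a)`, then `Σ_v d(v)² + (k − 2) ≤ m·k`. -/
theorem stability_of_cliqueFree_off_diagonal (D : SimpleGraph V) [DecidableRel D.Adj]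
    (hfree : D.CliqueFree 3)
    (hm : ∀ a, a ≤ Fintype.card V → D.edgeFinset.card ≠ a * (Fintype.card V - a)) :
    ∑ v, deg D v * deg D v + (Fintype.card V - 2) ≤ D.edgeFinset.card * Fintype.card V := by
  apply mantel_stability D hfree
  rintro ⟨A, hA⟩
  exact hm A.card (card_le_univ A) (card_edges_eq_of_complete_bipartite D A hA)

/-- The triangle-free cherry maximum off the diagonal is at most `(m − 1)(k − 2)/2`:
`2·Σ_v C(d(v), 2) + 2m + (k − 2) ≤ m·k`. -/
theorem cherries_le_of_cliqueFree_off_diagonal (D : SimpleGraph V) [DecidableRel D.Adj]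
    (hfree : D.CliqueFree 3)
    (hm : ∀ a, a ≤ Fintype.card V → D.edgeFinset.card ≠ a * (Fintype.card V - a)) :
    2 * cherries D + 2 * D.edgeFinset.card + (Fintype.card V - 2) ≤
      D.edgeFinset.card * Fintype.card V := by
  have h := stability_of_cliqueFree_off_diagonal D hfree hm
  rw [← two_mul_cherries_add, sum_deg_eq] at h
  exact h

/-- **TWO TRIANGLES PAY THE GAP FOR `k ≥ 10`:** `Σ_v d(v)² + (k − 2) ≤ m·k` once `12 ≤ |T₃|`. -/
theorem stability_of_two_triangles (D : SimpleGraph V) [DecidableRel D.Adj] (hK : K4mFree D)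
    (hk : 10 ≤ Fintype.card V) (hT : 12 ≤ (triangles3 D).card) :
    ∑ v, deg D v * deg D v + (Fintype.card V - 2) ≤ D.edgeFinset.card * Fintype.card V := by
  have h := six_mul_sum_deg_sq_add_triangles_le D hK (by omega)
  obtain ⟨j, hj⟩ := Nat.exists_eq_add_of_le hk
  rw [hj] at h ⊢
  have e1 : 10 + j - 6 = j + 4 := by omega
  have e2 : 10 + j - 2 = j + 8 := by omega
  rw [e1] at h
  rw [e2]
  have hmul : (j + 4) * 12 ≤ (j + 4) * (triangles3 D).card := Nat.mul_le_mul_left _ hT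
  nlinarith [h, hmul]

/-- **THE DENSE-CORNER STABILITY HOLDS FOR `k ≥ 10` AWAY FROM THE ONE-TRIANGLE CASE.** -/
theorem dense_stability_of_not_one_triangle (D : SimpleGraph V) [DecidableRel D.Adj] (hK : K4mFree D)
    (hk : 10 ≤ Fintype.card V)
    (hnot : ¬ ∃ A : Finset V, ∀ x y, D.Adj x y ↔ Xor (x ∈ A) (y ∈ A))
    (hT : (triangles3 D).card = 0 ∨ 12 ≤ (triangles3 D).card) :
    ∑ v, deg D v * deg D v + (Fintype.card V - 2) ≤ D.edgeFinset.card * Fintype.card V := by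
  rcases hT with h | h
  · exact mantel_stability D (cliqueFree_of_card_triangles3_eq_zero D h) hnot
  · exact stability_of_two_triangles D hK hk h

end C047

end TriangleCap

end PercRepro
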